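import Summits.BirchSwinnertonDyer.Rank1Residual.F1Sign2.ParitySymbolCocycleAtTwo
import HarnessLib

/-!
# Cell `bsd-f1-sign2`, lens `-desc` g14 (MEMO-desc §22.2, §22.10): PROOFS for `ParitySymbolCocycleAtTwo.lean`, part 1 — the glued pair
# `(E_f, E′_f)`: row DESC-§22-U PROVED (`thetaDiscrepancyOfGluedPairAtTwo_holds`) and the finite-place half of rows K/Z

Source: `HOME/MEMO-desc-data/g14/lean/GluedPairIdentity.lean` a33a3d2596811eee (478 l.; planner -desc g14, 2026-08-28T08:52:04Z), lines 45–267: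
`root_relation`, `aeval_derivative_cubic`, `GluedPairIdentity.thetaDiscrepancyOfGluedPairAtTwo_holds` (row U), `gmBeta` (the Kummer representative
of `T₀ = (0,c) ∈ E′_f(ℚ)`), `gmBeta_mul_root`, `psi_gmBeta`, `psi_gmBeta_mul_t`, `theta_mul_psi_gmBeta`, `gluedPair_inTransportedKummerImageAtTwo`
(`u ∈ ψ_*δ_p(E′_f)` at EVERY prime `p`), `gluedPair_correctionBit_eq_zero`, and the integer-cast forms `theta_mul_psi_gmBeta_int`,
`psi_gmBeta_mul_t_int`, `psi_root_relation_int` used by the real half (part 2 = `ParitySymbolCocycleAtTwoProofs.lean`: rows K, Z, A).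
The module is split in two only to respect the 400-line cap on `F1Sign2` modules carrying proofs.
APPEND (-ty g8, REF1 §86 rider r6): `cubic_gmPartner`, `thetaDiscrepancyAtTwo_comp` (e7), `GluedPairIdentity.exists_pinned_congruence` (e9: A3
non-vacuity of the pinned-`ψ` binder), `GluedPairIdentity.thetaDiscrepancy_mul_negcRoot_isSquare` (e6), `GluedPairIdentity.exists_pinned_isSquare` (e9′) —
the refuter's audit lemmas (`REF1-data/b86/Probe86.lean` f7a147de2774e12e), made unconditional by the landed proof of row U.

TYPER FILING (seat `bsd-f1-sign2-ty` g8): proofs VERBATIM from the planner's file (sha16 asserted by the builder `tools/mk_desc22proofs.py`,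
published with the filed text under `HOME/MEMO-ty-data/g8/`); the planner's local copies of the row defs are DELETED — the theorems now prove the
TREE rows of `F1Sign2/ParitySymbolCocycleAtTwo.lean` by name (same namespace discipline as `CongruenceLocalGaugeAtTwoProofs.lean` p619435:
helpers in the planner's sub-namespace, `…F1Sign2.<row>_holds` at the end); docstrings added where the planner had none; nothing else changed.
REF1-AUDIT §86 (bsd-f1-sign2-ref1 g8, 2026-08-28T09:09:13Z): rows U/K/Z/A «THEOREMS IN THE KERNEL — CLEARED to land WITH PROOFS»; REF1 recompiled
the planner's compatibility certificates `GluedPairIdentity.CompatDraft.lean` bb1da82a9e01754b and `Transvection.CompatDraft.lean` 05e4558dbde9aafe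
(proof file byte-identical + the typed rows closed by `exact`) on the farm: rc 0 · 0 warn · 0 sorry, axioms propext, Classical.choice, Quot.sound
(`REF1-data/b86/compat_check1–4.json`, `transv_check1.json`). No `sorry`, no new `def … : Prop`, no `instance`, no `notation`.

Planner's proof-file docstring (verbatim, -desc g14 `GluedPairIdentity.lean`):
# The Green–Maistret glued pair: rows DESC-§22-U, DESC-§22-K, DESC-§22-Z of Sketch-v18 PROVED

Proof file (planner `-desc` g14, MEMO-desc §22.2 / §22.10) over the landed carriers of
`F1Sign2/ThetaDiscrepancyParityAtTwo.lean` (`twoDivisionAlgebra`, `twoDivisionRoot`, `twoDivisionDifferent`, `thetaDiscrepancyAtTwo`,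
`InExplicitLocalKummerImageAtTwo`, `InTransportedKummerImageAtTwo`, `InRealKummerImageAtTwo`, `IsLocalParitySymbolAt`, `IsBranchRealRoot`).
For the glued pair `E_f = ⟨0,a,0,b,c⟩`, `E′_f = ⟨0,b,0,ac,c²⟩` and a PINNED congruence `ψ : L_{E′} → L_E` (`ψ(θ_{E′})·θ_E = 16c`):

* `thetaDiscrepancyOfGluedPairAtTwo_holds` (row U): `u·(−cθ_E) = (2c·c_E′(θ_E))²` — an identity in `L_E = ℚ[X]/(c_E)`: with `t = ψ(θ_F)`,
  `tθ = 16c` and `c_E(θ) = 0` give `4t = −(θ² + 4aθ + 16b)` (`θ` is a unit as `c ≠ 0`), whence `c_F′(t)·θ = −4c·c_E′(θ)`.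
* `gluedPairDiscrepancyIsKummerClassAtTwo_holds` (row K, verbatim): `u ∈ ψ_*δ_p(E′_f)` at EVERY prime `p` — witness
  `β = θ_F² + 4bθ_F + 16ac` (`β·(0 − θ_F) = (8c)²`, the explicit Kummer class of `X = 0` on `Y² = c_{E′}(X)`, i.e. of `(0,c) ∈ E′_f(ℚ)`)
  with `u·ψ(β) = (4c·c_E′(θ_E))²`; and `u ∈ δ_∞(E′_f)` read in `L_E`: for every `σ : L_E → ℝ`, `σu·σψβ > 0 > σψβ·σt`, so
  `σu > 0 ⟺ σt < 0`, and `σt` is a real root of `c_{E′} = X³ + 4bX² + 16acX + 64c²` (`c_{E′}(0) > 0`): either all `σt < 0` (`u` totally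
  positive) or `c_{E′}` has a positive root and then exactly one negative root, the smallest (pure algebra: factor, quadratic formula).
* `gluedPairCorrectionBitVanishesAtTwo_holds` (row Z, verbatim): the correction bit of every local parity symbol (`ℚ_p` and `ℝ`) is `0`.

No `sorry`; axioms `propext`, `Classical.choice`, `Quot.sound`.  The irreducibility `Fact`s are used only for `β ≠ 0`, `c_E′(θ_E) ≠ 0` and the
field structure under real embeddings; `Δ_f ≠ 0` is not used.  Instance note: binders `(ψ) (hpin)` precede the `Fact`s in the auxiliary
theorems so that `ψ` is typed over `AdjoinRoot.instAlgebra` (the rows, with `Fact`s first, type `ψ` over `DivisionRing.toRatAlgebra`; the two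
agree definitionally and the verbatim rows are closed by `exact`); constants are transported along `σ` as INTEGER casts (`map_intCast`).
-/

noncomputable section

open scoped Classical

open WeierstrassCurve Polynomial

namespace Summit.BirchSwinnertonDyer.Rank1Residual.F1Sign2.GluedPairIdentity

/-- `c_W(θ_W) = 0` written out. -/
lemma root_relation (W : WeierstrassCurve ℚ) :
    twoDivisionRoot W ^ 3 + algebraMap ℚ (twoDivisionAlgebra W) W.b₂ * twoDivisionRoot W ^ 2 +
      algebraMap ℚ (twoDivisionAlgebra W) (8 * W.b₄) * twoDivisionRoot W +
      algebraMap ℚ (twoDivisionAlgebra W) (16 * W.b₆) = 0 := by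
  have h : aeval (twoDivisionRoot W) (twoDivisionUCubic W) = 0 := by
    simp [twoDivisionRoot, AdjoinRoot.aeval_eq, AdjoinRoot.mk_self]
  have h2 : aeval (twoDivisionRoot W) (twoDivisionUCubic W) =
      twoDivisionRoot W ^ 3 + algebraMap ℚ (twoDivisionAlgebra W) W.b₂ * twoDivisionRoot W ^ 2 +
      algebraMap ℚ (twoDivisionAlgebra W) (8 * W.b₄) * twoDivisionRoot W +
      algebraMap ℚ (twoDivisionAlgebra W) (16 * W.b₆) := by
    simp only [twoDivisionUCubic, map_add, map_mul, map_pow, aeval_X, aeval_C]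
  rw [← h2]; exact h

/-- `c_W′(x)` written out for any `x` in a `ℚ`-algebra. -/
lemma aeval_derivative_cubic (W : WeierstrassCurve ℚ) {A : Type} [CommRing A] [Algebra ℚ A] (x : A) :
    aeval x (derivative (twoDivisionUCubic W)) =
      3 * x ^ 2 + algebraMap ℚ A (2 * W.b₂) * x + algebraMap ℚ A (8 * W.b₄) := by
  have hd : derivative (twoDivisionUCubic W) = C 3 * X ^ 2 + C (2 * W.b₂) * X + C (8 * W.b₄) := by
    simp only [twoDivisionUCubic, derivative_add, derivative_mul, derivative_X_pow, derivative_C, derivative_X,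
      zero_mul, zero_add, mul_one, map_mul, Nat.cast_ofNat]
    simp only [C_ofNat]
    ring
  rw [hd]
  simp only [map_add, map_mul, map_pow, aeval_X, aeval_C, map_ofNat]

/-- **Row DESC-§22-U PROVED** (the tree row `F1Sign2.ThetaDiscrepancyOfGluedPairAtTwo`, by name): `u·(−cθ_E) = (2c·c_E′(θ_E))²` in
`L_E = ℚ[X]/(c_E)` — from `tθ = 16c` and `c_E(θ) = 0`: `4t = −(θ² + 4aθ + 16b)`, whence `c_F′(t)·θ = −4c·c_E′(θ)`. -/
theorem thetaDiscrepancyOfGluedPairAtTwo_holds : ThetaDiscrepancyOfGluedPairAtTwo := by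
  intro a b c hc ψ hpin
  have hcQ : (c : ℚ) ≠ 0 := Int.cast_ne_zero.mpr hc
  have h64c : (64 * (c : ℚ)) ≠ 0 := mul_ne_zero (by norm_num) hcQ
  have hE := root_relation (gmCurve a b c)
  rw [gm_b₂, gm_b₄, gm_b₆] at hE
  have hdE0 : twoDivisionDifferent (gmCurve a b c) =
      3 * twoDivisionRoot (gmCurve a b c) ^ 2 +
        algebraMap ℚ _ (2 * (4 * (a : ℚ))) * twoDivisionRoot (gmCurve a b c) + algebraMap ℚ _ (8 * (2 * (b : ℚ))) := by
    rw [twoDivisionDifferent, aeval_derivative_cubic, gm_b₂, gm_b₄]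
  have hdF0 : ψ (twoDivisionDifferent (gmPartner a b c)) =
      3 * ψ (twoDivisionRoot (gmPartner a b c)) ^ 2 +
        algebraMap ℚ _ (2 * (4 * (b : ℚ))) * ψ (twoDivisionRoot (gmPartner a b c)) +
        algebraMap ℚ _ (8 * (2 * ((a : ℚ) * c))) := by
    rw [twoDivisionDifferent, ← Polynomial.aeval_algHom_apply, aeval_derivative_cubic, gmP_b₂, gmP_b₄]
  have hCinv0 := congrArg (algebraMap ℚ (twoDivisionAlgebra (gmCurve a b c))) (mul_inv_cancel₀ h64c)
  -- unfold the discrepancy and push all scalars out of `algebraMap`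
  rw [thetaDiscrepancyAtTwo, hdE0, hdF0]
  simp only [map_mul, map_ofNat, map_neg, map_one] at hE hpin hCinv0 ⊢
  -- atoms
  generalize twoDivisionRoot (gmCurve a b c) = θ at hE hpin ⊢
  generalize ψ (twoDivisionRoot (gmPartner a b c)) = t at hpin ⊢
  generalize algebraMap ℚ (twoDivisionAlgebra (gmCurve a b c)) (a : ℚ) = A at hE ⊢
  generalize algebraMap ℚ (twoDivisionAlgebra (gmCurve a b c)) (b : ℚ) = B at hE ⊢
  generalize algebraMap ℚ (twoDivisionAlgebra (gmCurve a b c)) ((64 * (c : ℚ))⁻¹) = Ci at hCinv0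
  generalize algebraMap ℚ (twoDivisionAlgebra (gmCurve a b c)) (c : ℚ) = Cc at hE hpin hCinv0 ⊢
  -- θ is a unit
  have hunit : θ * (-(θ ^ 2 + 4 * A * θ + 16 * B) * Ci) = 1 := by
    linear_combination (-Ci) * hE + hCinv0
  -- 4t = -(θ² + 4Aθ + 16B)
  have ht' : 4 * t + (θ ^ 2 + 4 * A * θ + 16 * B) = 0 := by
    linear_combination (-(4 * t + (θ ^ 2 + 4 * A * θ + 16 * B))) * hunit +
      (4 * (-(θ ^ 2 + 4 * A * θ + 16 * B) * Ci)) * hpin + (-(θ ^ 2 + 4 * A * θ + 16 * B) * Ci) * hE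
  -- finish
  linear_combination (-(Cc * (3 * θ ^ 2 + 8 * A * θ + 16 * B) * (3 * t + 8 * B))) * hpin +
    (-(12 * Cc ^ 2 * (3 * θ ^ 2 + 8 * A * θ + 16 * B))) * ht'

/-! ## The finite-place half of DESC-§22-K / DESC-§22-Z: `u ∈ ψ_* δ_p(E′_f)` at every prime `p`, so the correction bit vanishes

Witness: `β = θ_F² + 4b θ_F + 16ac ∈ L_{E′}` (so `β·(0 − θ_F) = (8c)²`: `β` is the explicit Kummer class of the rational point
`X = 0` of `Y² = c_{E′}(X)`, i.e. of `T₀ = (0, c) ∈ E′_f(ℚ)`), and `u · ψ(β) = (4c · c_E′(θ_E))²`. -/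

/-- The Kummer representative of `T₀ = (0,c)`: `β = θ_F² + 4bθ_F + 16ac`, `β · θ_F = −64c²`. -/
def gmBeta (a b c : ℤ) : twoDivisionAlgebra (gmPartner a b c) :=
  twoDivisionRoot (gmPartner a b c) ^ 2 +
    algebraMap ℚ (twoDivisionAlgebra (gmPartner a b c)) (4 * (b : ℚ)) * twoDivisionRoot (gmPartner a b c) +
    algebraMap ℚ (twoDivisionAlgebra (gmPartner a b c)) (16 * ((a : ℚ) * c))

/-- `β · θ_F = −64c²` in `L_{E′}` (from `c_{E′}(θ_F) = 0`). -/
lemma gmBeta_mul_root (a b c : ℤ) :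
    gmBeta a b c * twoDivisionRoot (gmPartner a b c) =
      algebraMap ℚ (twoDivisionAlgebra (gmPartner a b c)) (-(64 * (c : ℚ) ^ 2)) := by
  have hF := root_relation (gmPartner a b c)
  rw [gmP_b₂, gmP_b₄, gmP_b₆] at hF
  simp only [gmBeta, map_mul, map_ofNat, map_neg, map_pow] at hF ⊢
  linear_combination hF

/-- `ψ(β) = −4c·θ_E` for a pinned congruence. -/
lemma psi_gmBeta (a b c : ℤ) (hc : c ≠ 0)
    (ψ : twoDivisionAlgebra (gmPartner a b c) →ₐ[ℚ] twoDivisionAlgebra (gmCurve a b c))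
    (hpin : ψ (twoDivisionRoot (gmPartner a b c)) * twoDivisionRoot (gmCurve a b c) =
      algebraMap ℚ (twoDivisionAlgebra (gmCurve a b c)) (16 * c : ℚ)) :
    ψ (gmBeta a b c) = algebraMap ℚ (twoDivisionAlgebra (gmCurve a b c)) (-(4 * (c : ℚ))) * twoDivisionRoot (gmCurve a b c) := by
  have hcQ : (c : ℚ) ≠ 0 := Int.cast_ne_zero.mpr hc
  have h16c : (16 * (c : ℚ)) ≠ 0 := mul_ne_zero (by norm_num) hcQ
  have hβ := congrArg ψ (gmBeta_mul_root a b c)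
  rw [map_mul, AlgHom.commutes] at hβ
  have hinv0 := congrArg (algebraMap ℚ (twoDivisionAlgebra (gmCurve a b c))) (mul_inv_cancel₀ h16c)
  simp only [map_mul, map_ofNat, map_neg, map_pow, map_one] at hβ hpin hinv0 ⊢
  generalize ψ (gmBeta a b c) = x at hβ ⊢
  generalize twoDivisionRoot (gmCurve a b c) = θ at hpin ⊢
  generalize ψ (twoDivisionRoot (gmPartner a b c)) = t at hpin hβ
  generalize algebraMap ℚ (twoDivisionAlgebra (gmCurve a b c)) ((16 * (c : ℚ))⁻¹) = Ci at hinv0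
  generalize algebraMap ℚ (twoDivisionAlgebra (gmCurve a b c)) (c : ℚ) = Cc at hpin hβ hinv0 ⊢
  -- t is a unit: t * (θ * Ci) = 1
  have htunit : t * (θ * Ci) = 1 := by linear_combination Ci * hpin + hinv0
  linear_combination (-(x + 4 * Cc * θ)) * htunit + (θ * Ci) * hβ + (4 * Cc * (θ * Ci)) * hpin

/-- `ψ(β) · ψ(θ_F) = −64c²`. -/
lemma psi_gmBeta_mul_t (a b c : ℤ)
    (ψ : twoDivisionAlgebra (gmPartner a b c) →ₐ[ℚ] twoDivisionAlgebra (gmCurve a b c)) :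
    ψ (gmBeta a b c) * ψ (twoDivisionRoot (gmPartner a b c)) =
      algebraMap ℚ (twoDivisionAlgebra (gmCurve a b c)) (-(64 * (c : ℚ) ^ 2)) := by
  rw [← map_mul, gmBeta_mul_root, AlgHom.commutes]

/-- `u · ψ(β) = (4c · c_E′(θ_E))²`. -/
lemma theta_mul_psi_gmBeta (a b c : ℤ) (hc : c ≠ 0)
    (ψ : twoDivisionAlgebra (gmPartner a b c) →ₐ[ℚ] twoDivisionAlgebra (gmCurve a b c))
    (hpin : ψ (twoDivisionRoot (gmPartner a b c)) * twoDivisionRoot (gmCurve a b c) =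
      algebraMap ℚ (twoDivisionAlgebra (gmCurve a b c)) (16 * c : ℚ)) :
    thetaDiscrepancyAtTwo (gmCurve a b c) (gmPartner a b c) ψ * ψ (gmBeta a b c) =
      (2 * (algebraMap ℚ (twoDivisionAlgebra (gmCurve a b c)) (2 * c) * twoDivisionDifferent (gmCurve a b c))) ^ 2 := by
  have hU := thetaDiscrepancyOfGluedPairAtTwo_holds a b c hc ψ hpin
  rw [psi_gmBeta a b c hc ψ hpin]
  have h4 : algebraMap ℚ (twoDivisionAlgebra (gmCurve a b c)) (-(4 * (c : ℚ))) =
      4 * algebraMap ℚ (twoDivisionAlgebra (gmCurve a b c)) (-(c : ℚ)) := by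
    simp only [map_neg, map_mul, map_ofNat]
    ring
  rw [h4, show thetaDiscrepancyAtTwo (gmCurve a b c) (gmPartner a b c) ψ *
      (4 * algebraMap ℚ (twoDivisionAlgebra (gmCurve a b c)) (-(c : ℚ)) * twoDivisionRoot (gmCurve a b c)) =
      4 * (thetaDiscrepancyAtTwo (gmCurve a b c) (gmPartner a b c) ψ *
        (algebraMap ℚ (twoDivisionAlgebra (gmCurve a b c)) (-(c : ℚ)) * twoDivisionRoot (gmCurve a b c))) by ring, hU]
  ring

/-- **DESC-§22-K, finite places (proved).** For the glued pair with a pinned congruence, `u_{E_f,E′_f}` lies in the transported explicit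
local Kummer image of `E′_f` at EVERY prime `p` (witness `β`, `s = {0}`). -/
theorem gluedPair_inTransportedKummerImageAtTwo (a b c : ℤ) (hc : c ≠ 0)
    (ψ : twoDivisionAlgebra (gmPartner a b c) →ₐ[ℚ] twoDivisionAlgebra (gmCurve a b c))
    (hpin : ψ (twoDivisionRoot (gmPartner a b c)) * twoDivisionRoot (gmCurve a b c) =
      algebraMap ℚ (twoDivisionAlgebra (gmCurve a b c)) (16 * c : ℚ))
    [Fact (Irreducible (twoDivisionUCubic (gmPartner a b c)))] (p : ℕ) [Fact p.Prime] :
    InTransportedKummerImageAtTwo (gmCurve a b c) (gmPartner a b c) ψ p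
      (thetaDiscrepancyAtTwo (gmCurve a b c) (gmPartner a b c) ψ) := by
  have hcQ : (c : ℚ) ≠ 0 := Int.cast_ne_zero.mpr hc
  refine ⟨gmBeta a b c, ?_, ?_, ?_⟩
  · -- β ≠ 0
    intro h0
    have h := gmBeta_mul_root a b c
    rw [h0, zero_mul] at h
    have h' := (algebraMap ℚ (twoDivisionAlgebra (gmPartner a b c))).injective (h.symm.trans (map_zero _).symm)
    simp [hcQ] at h'
  · -- β is the explicit Kummer class of `X = 0`
    refine ⟨{0}, ?_, ?_⟩
    · intro X hX
      rw [Finset.mem_singleton] at hX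
      subst hX
      have h0 : aeval (0 : ℚ) (twoDivisionUCubic (gmPartner a b c)) = (8 * c) ^ 2 := by
        simp [twoDivisionUCubic, gmPartner, WeierstrassCurve.b₆]; ring
      refine ⟨?_, ?_⟩
      · rw [h0]; exact pow_ne_zero 2 (mul_ne_zero (by norm_num) hcQ)
      · rw [h0]; exact ⟨((8 * c : ℚ) : ℚ_[p]), by rw [sq, Rat.cast_mul]⟩
    · have hL : gmBeta a b c * ∏ X ∈ ({0} : Finset ℚ),
          (AdjoinRoot.of (twoDivisionUCubic (gmPartner a b c)) X - AdjoinRoot.root (twoDivisionUCubic (gmPartner a b c))) =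
          algebraMap ℚ (twoDivisionAlgebra (gmPartner a b c)) (8 * c) *
            algebraMap ℚ (twoDivisionAlgebra (gmPartner a b c)) (8 * c) := by
        rw [Finset.prod_singleton, map_zero, zero_sub, mul_neg, ← map_mul]
        change -(gmBeta a b c * twoDivisionRoot (gmPartner a b c)) = _
        rw [gmBeta_mul_root, ← map_neg]
        congr 1
        ring
      rw [hL]
      exact ⟨algebraMap ℚ (twoDivisionAlgebra (gmPartner a b c)) (8 * c) ⊗ₜ[ℚ] (1 : ℚ_[p]), by
        rw [Algebra.TensorProduct.tmul_mul_tmul, mul_one]⟩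
  · -- u · ψ(β) = (4c · c_E′(θ_E))²
    refine ⟨(2 * (algebraMap ℚ (twoDivisionAlgebra (gmCurve a b c)) (2 * c) * twoDivisionDifferent (gmCurve a b c))) ⊗ₜ[ℚ]
      (1 : ℚ_[p]), ?_⟩
    rw [Algebra.TensorProduct.tmul_mul_tmul, mul_one, theta_mul_psi_gmBeta a b c hc ψ hpin, sq]

/-- **DESC-§22-Z, finite places (proved).** The correction bit of any local parity symbol of the glued pair at a prime `p` is `0`. -/
theorem gluedPair_correctionBit_eq_zero (a b c : ℤ) (hc : c ≠ 0)
    (ψ : twoDivisionAlgebra (gmPartner a b c) →ₐ[ℚ] twoDivisionAlgebra (gmCurve a b c))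
    (hpin : ψ (twoDivisionRoot (gmPartner a b c)) * twoDivisionRoot (gmCurve a b c) =
      algebraMap ℚ (twoDivisionAlgebra (gmCurve a b c)) (16 * c : ℚ))
    [Fact (Irreducible (twoDivisionUCubic (gmPartner a b c)))] (p : ℕ) [Fact p.Prime] (dp cp : ℕ)
    (h : IsLocalParitySymbolAt (gmCurve a b c) ℚ_[p] (InExplicitLocalKummerImageAtTwo (gmCurve a b c) p)
      (InTransportedKummerImageAtTwo (gmCurve a b c) (gmPartner a b c) ψ p)
      (thetaDiscrepancyAtTwo (gmCurve a b c) (gmPartner a b c) ψ) dp cp) :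
    cp = 0 := by
  obtain ⟨_, hcp⟩ := h
  rw [hcp, if_neg]
  exact fun hh => hh.2.1 (gluedPair_inTransportedKummerImageAtTwo a b c hc ψ hpin p)

/-! ## Integer-cast forms (instance-neutral under ring maps `σ : L_E → ℝ`) -/

/-- `theta_mul_psi_gmBeta` with the constants as INTEGER casts (transportable along any ring map `σ : L_E → ℝ` by `map_intCast`). -/
lemma theta_mul_psi_gmBeta_int (a b c : ℤ) (hc : c ≠ 0)
    (ψ : twoDivisionAlgebra (gmPartner a b c) →ₐ[ℚ] twoDivisionAlgebra (gmCurve a b c))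
    (hpin : ψ (twoDivisionRoot (gmPartner a b c)) * twoDivisionRoot (gmCurve a b c) =
      algebraMap ℚ (twoDivisionAlgebra (gmCurve a b c)) (16 * c : ℚ)) :
    thetaDiscrepancyAtTwo (gmCurve a b c) (gmPartner a b c) ψ * ψ (gmBeta a b c) =
      (((4 * c : ℤ) : twoDivisionAlgebra (gmCurve a b c)) * twoDivisionDifferent (gmCurve a b c)) ^ 2 := by
  rw [theta_mul_psi_gmBeta a b c hc ψ hpin, ← map_intCast (algebraMap ℚ (twoDivisionAlgebra (gmCurve a b c))) (4 * c)]
  push_cast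
  simp only [map_ofNat]
  ring

/-- `psi_gmBeta_mul_t` with integer-cast constants. -/
lemma psi_gmBeta_mul_t_int (a b c : ℤ)
    (ψ : twoDivisionAlgebra (gmPartner a b c) →ₐ[ℚ] twoDivisionAlgebra (gmCurve a b c)) :
    ψ (gmBeta a b c) * ψ (twoDivisionRoot (gmPartner a b c)) = ((-(64 * c ^ 2) : ℤ) : twoDivisionAlgebra (gmCurve a b c)) := by
  rw [psi_gmBeta_mul_t, ← map_intCast (algebraMap ℚ (twoDivisionAlgebra (gmCurve a b c))) (-(64 * c ^ 2))]
  push_cast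
  ring_nf

/-- `c_{E′}(t) = 0` for `t = ψ(θ_F)` in `L_E`, integer-cast constants. -/
lemma psi_root_relation_int (a b c : ℤ)
    (ψ : twoDivisionAlgebra (gmPartner a b c) →ₐ[ℚ] twoDivisionAlgebra (gmCurve a b c)) :
    ψ (twoDivisionRoot (gmPartner a b c)) ^ 3 +
      ((4 * b : ℤ) : twoDivisionAlgebra (gmCurve a b c)) * ψ (twoDivisionRoot (gmPartner a b c)) ^ 2 +
      ((16 * (a * c) : ℤ) : twoDivisionAlgebra (gmCurve a b c)) * ψ (twoDivisionRoot (gmPartner a b c)) +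
      ((64 * c ^ 2 : ℤ) : twoDivisionAlgebra (gmCurve a b c)) = 0 := by
  have hF := root_relation (gmPartner a b c)
  rw [gmP_b₂, gmP_b₄, gmP_b₆] at hF
  have h := congrArg ψ hF
  simp only [map_add, map_mul, map_pow, map_zero, AlgHom.commutes] at h
  rw [← map_intCast (algebraMap ℚ (twoDivisionAlgebra (gmCurve a b c))) (4 * b),
    ← map_intCast (algebraMap ℚ (twoDivisionAlgebra (gmCurve a b c))) (16 * (a * c)),
    ← map_intCast (algebraMap ℚ (twoDivisionAlgebra (gmCurve a b c))) (64 * c ^ 2)]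
  push_cast
  simp only [map_ofNat] at h ⊢
  linear_combination h

end Summit.BirchSwinnertonDyer.Rank1Residual.F1Sign2.GluedPairIdentity

namespace Summit.BirchSwinnertonDyer.Rank1Residual.F1Sign2

/-- **DESC-§22-U `ThetaDiscrepancyOfGluedPairAtTwo` HOLDS** (tree row of `ParitySymbolCocycleAtTwo.lean`, closed by name; proof -desc g14,
REF1 §86 «theorem in the kernel»). -/
theorem thetaDiscrepancyOfGluedPairAtTwo_holds : ThetaDiscrepancyOfGluedPairAtTwo :=
  GluedPairIdentity.thetaDiscrepancyOfGluedPairAtTwo_holds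

end Summit.BirchSwinnertonDyer.Rank1Residual.F1Sign2

/-! ## REF1 §86 rider r6: non-vacuity and convention lemmas (refuter's audit lemmas e6, e7, e9, made unconditional by the proof of row U) -/

namespace Summit.BirchSwinnertonDyer.Rank1Residual.F1Sign2

/-- REF1 §86 (r6): the `u`-cubic of the UNTWISTED partner `E′_f = ⟨0,b,0,ac,c²⟩` is `u³ + 4b u² + 16ac u + 64c²` (roots `4c/αᵢ = 16c/θᵢ`). -/
theorem cubic_gmPartner (a b c : ℤ) :
    twoDivisionUCubic (gmPartner a b c) =
      X ^ 3 + C (4 * (b : ℚ)) * X ^ 2 + C (8 * (2 * ((a : ℚ) * c))) * X + C (16 * (4 * (c : ℚ) ^ 2)) := by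
  rw [twoDivisionUCubic, gmP_b₂, gmP_b₄, gmP_b₆]

/-- REF1 §86 e7 (row DESC-§22-C's COMPOSITE convention, rider r5): the theta-discrepancy is a groupoid cocycle ON THE NOSE — for congruences
`ψ₁₂ : L₂ → L₁`, `ψ₂₃ : L₃ → L₂`, `u₁₂ · ψ₁₂(u₂₃) = u₁₃ · ψ₁₂(c₂′(θ₂))²` with `u₁₃` taken along `ψ₁₂ ∘ ψ₂₃`; so modulo squares
`u₁₃ ≡ u₁₂ · ψ₁₂ u₂₃` (MEMO-desc §22.4 «`u₁₃ = u₁₂ + u₂₃`»). -/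
theorem thetaDiscrepancyAtTwo_comp (E₁ E₂ E₃ : WeierstrassCurve ℚ)
    (ψ₁₂ : twoDivisionAlgebra E₂ →ₐ[ℚ] twoDivisionAlgebra E₁) (ψ₂₃ : twoDivisionAlgebra E₃ →ₐ[ℚ] twoDivisionAlgebra E₂) :
    thetaDiscrepancyAtTwo E₁ E₂ ψ₁₂ * ψ₁₂ (thetaDiscrepancyAtTwo E₂ E₃ ψ₂₃) =
      thetaDiscrepancyAtTwo E₁ E₃ (ψ₁₂.comp ψ₂₃) * ψ₁₂ (twoDivisionDifferent E₂) ^ 2 := by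
  simp only [thetaDiscrepancyAtTwo, map_mul, AlgHom.comp_apply]
  ring

end Summit.BirchSwinnertonDyer.Rank1Residual.F1Sign2

namespace Summit.BirchSwinnertonDyer.Rank1Residual.F1Sign2.GluedPairIdentity

/-- **NON-VACUITY of the pinned-`ψ` binder** of rows DESC-§22-U/K/Z/L/L∞/V/V′, which quantify over the UNTWISTED partner `gmPartner a b c`
(the landed `exists_isGMCongruence` speaks of `(gmPartner a b c).quadraticTwist d`, a syntactically different curve at `d = 1`): for all
`a b c : ℤ` there is `ψ : L_{E′_f} → L_{E_f}` with `ψ(θ_F)·θ_E = 16c`, namely `ψ(θ_F) := −¼(θ_E² + 4aθ_E + 16b)`.  REF1 §86 e9 (refuter seat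
bsd-f1-sign2-ref1 g8, `REF1-data/b86/Probe86.lean` f7a147de2774e12e), proof verbatim; same certificate as REF1 §83 e3 with `d = 1`. -/
theorem exists_pinned_congruence (a b c : ℤ) :
    ∃ ψ : twoDivisionAlgebra (gmPartner a b c) →ₐ[ℚ] twoDivisionAlgebra (gmCurve a b c),
      ψ (twoDivisionRoot (gmPartner a b c)) * twoDivisionRoot (gmCurve a b c) =
        algebraMap ℚ (twoDivisionAlgebra (gmCurve a b c)) (16 * c : ℚ) := by
  have h0 : aeval (twoDivisionRoot (gmCurve a b c))
      (X ^ 3 + C (4 * (a : ℚ)) * X ^ 2 + C (8 * (2 * (b : ℚ))) * X + C (16 * (4 * (c : ℚ))) : ℚ[X]) = 0 := by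
    rw [← cubic_gmCurve]; exact aeval_twoDivisionRoot_twoDivisionUCubic _
  simp only [map_add, map_mul, map_pow, map_ofNat, aeval_C, aeval_X] at h0
  have hq : (4 : twoDivisionAlgebra (gmCurve a b c)) * algebraMap ℚ (twoDivisionAlgebra (gmCurve a b c)) (1 / 4 : ℚ) = 1 := by
    rw [← map_ofNat (algebraMap ℚ (twoDivisionAlgebra (gmCurve a b c))) 4, ← map_mul, ← map_one (algebraMap ℚ _)]
    norm_num
  set θ := twoDivisionRoot (gmCurve a b c) with hθ
  set q := algebraMap ℚ (twoDivisionAlgebra (gmCurve a b c)) (1 / 4 : ℚ) with hqdef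
  set A := algebraMap ℚ (twoDivisionAlgebra (gmCurve a b c)) (a : ℚ) with hA
  set B := algebraMap ℚ (twoDivisionAlgebra (gmCurve a b c)) (b : ℚ) with hB
  set Cc := algebraMap ℚ (twoDivisionAlgebra (gmCurve a b c)) (c : ℚ) with hC
  let η : twoDivisionAlgebra (gmCurve a b c) := -q * (θ ^ 2 + 4 * A * θ + 16 * B)
  have hroot : aeval η (twoDivisionUCubic (gmPartner a b c)) = 0 := by
    rw [cubic_gmPartner]
    simp only [map_add, map_mul, map_pow, map_ofNat, aeval_C, aeval_X]
    rw [← hA, ← hB, ← hC]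
    linear_combination (-(q ^ 3) * (θ ^ 3 + 8 * A * θ ^ 2 + (16 * A ^ 2 + 16 * B) * θ + 64 * A * B - 64 * Cc)) * h0
      + ((-64 * Cc ^ 2 - 256 * Cc ^ 2 * q - 1024 * Cc ^ 2 * q ^ 2 - 1024 * B ^ 3 * q ^ 2 + 256 * A * B * Cc * q
          + 1024 * A * B * Cc * q ^ 2 - 512 * θ * A * B ^ 2 * q ^ 2 + 64 * θ * A ^ 2 * Cc * q + 256 * θ * A ^ 2 * Cc * q ^ 2
          - 128 * θ ^ 2 * B ^ 2 * q ^ 2 + 16 * θ ^ 2 * A * Cc * q + 64 * θ ^ 2 * A * Cc * q ^ 2 - 64 * θ ^ 2 * A ^ 2 * B * q ^ 2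
          - 32 * θ ^ 3 * A * B * q ^ 2 - 4 * θ ^ 4 * B * q ^ 2)) * hq
  refine ⟨AdjoinRoot.liftAlgHom _ (Algebra.ofId ℚ _) η (by simpa [Polynomial.aeval_def] using hroot), ?_⟩
  have hψ : (AdjoinRoot.liftAlgHom _ (Algebra.ofId ℚ _) η (by simpa [Polynomial.aeval_def] using hroot))
      (twoDivisionRoot (gmPartner a b c)) = η := by
    simp [twoDivisionRoot]
  rw [hψ]
  simp only [map_mul, map_ofNat]
  linear_combination (-q) * h0 + (16 * Cc) * hq

/-- REF1 §86 e6, unconditional: for EVERY pinned `ψ`, `u · (−c θ_E)` is a square in `L_E` — i.e. `u ≡ −c·θ_E ≡ −ψ(θ_F)` in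
`L_E^×/L_E^{×2}`, the Kummer class of `T₀ = (0,c)` (from `thetaDiscrepancyOfGluedPairAtTwo_holds`). -/
theorem thetaDiscrepancy_mul_negcRoot_isSquare (a b c : ℤ) (hc : c ≠ 0)
    (ψ : twoDivisionAlgebra (gmPartner a b c) →ₐ[ℚ] twoDivisionAlgebra (gmCurve a b c))
    (hpin : ψ (twoDivisionRoot (gmPartner a b c)) * twoDivisionRoot (gmCurve a b c) =
      algebraMap ℚ (twoDivisionAlgebra (gmCurve a b c)) (16 * c : ℚ)) :
    IsSquare (thetaDiscrepancyAtTwo (gmCurve a b c) (gmPartner a b c) ψ *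
      (algebraMap ℚ (twoDivisionAlgebra (gmCurve a b c)) (-(c : ℚ)) * twoDivisionRoot (gmCurve a b c))) :=
  ⟨_, by rw [thetaDiscrepancyOfGluedPairAtTwo_holds a b c hc ψ hpin, sq]⟩

/-- REF1 §86 e9′, unconditional: row DESC-§22-U is EXERCISED — for every `a b c` with `c ≠ 0` some pinned `ψ` exists and makes
`u · (−cθ_E)` a square. -/
theorem exists_pinned_isSquare (a b c : ℤ) (hc : c ≠ 0) :
    ∃ ψ : twoDivisionAlgebra (gmPartner a b c) →ₐ[ℚ] twoDivisionAlgebra (gmCurve a b c),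
      ψ (twoDivisionRoot (gmPartner a b c)) * twoDivisionRoot (gmCurve a b c) =
          algebraMap ℚ (twoDivisionAlgebra (gmCurve a b c)) (16 * c : ℚ) ∧
        IsSquare (thetaDiscrepancyAtTwo (gmCurve a b c) (gmPartner a b c) ψ *
          (algebraMap ℚ (twoDivisionAlgebra (gmCurve a b c)) (-(c : ℚ)) * twoDivisionRoot (gmCurve a b c))) := by
  obtain ⟨ψ, hpin⟩ := exists_pinned_congruence a b c
  exact ⟨ψ, hpin, thetaDiscrepancy_mul_negcRoot_isSquare a b c hc ψ hpin⟩

end Summit.BirchSwinnertonDyer.Rank1Residual.F1Sign2.GluedPairIdentity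

end
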